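import Summits.QuantumFields.YangMills.Theorems.BalabanUVNodesN15KingModelFullPropagatorGradSourceHolderSlice

/-!
# BalabanUVNodes ∕ N15 — THE KING-MODEL RUNG, CURVED EDITION (PART W-a, sequel): HÖLDER IN THE OBSERVATION POINT, DERIVATIVE ON THE SOURCE —
# the kernel profile `(|x − x′|∕N)^{−α}·|∂^{(2)}_νG^η_K(x′, y) − ∂^{(2)}_νG^η_K(x, y)| ≤ C·Σ_{i<K}(ΛL)^i(L^i)^α·e^{−δ·m·L^i∕N}` for ALL `x, x′, y`
# (`m = dist({x, x′}, y)`) = King's Prop. 3.7 (3.65) with `a = 0`, `|b| = 1` SUMMED over (2.17) — the kernel of [B9]'s (3.43) second Hölder entry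
# `‖ζG∇*_Uλ‖_β` at `U ≡ 1`, UNIFORMLY in `K`, the volume and the mass
# (Track A, DAG node N15 = NE2; FAN-OUT v1.1 §N15 s3 «KING-MODEL RUNG … + the one-line statement of what the curved case adds»)

HONEST FRAMING.  Count-neutral kernel bookkeeping (cell `pub-ymgap`, seat `pub-ymgap-dag-n15-e` g9; `--supports stmt-QuantumFields-20544
--as helper` = K3⁷ `SpineGivenEndpointR13SepCoPH`, WORDS-143).  TEMPLATE LITERATURE, `A = 0`: C. King's scalar U(1)-Higgs MODEL on finite tori ([King1986]
§2.2 p. 653 (2.13)–(2.17), p. 654 (2.20), (3.62) p. 663, Prop. 3.7 (3.65) p. 663 «`|(∂_α(x, y)D^a_xD^b_zG_{(j)})(z)| ≤ C(L^jη)^{2−d−|a|−|b|−α}exp[−δ₀(L^jη)^{−1}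
dist({x, y}, z)]`»; King's `d` = this file's `d + 1`), NOT Bałaban's covariant objects; the profile below is the (2.17)-SUMMED SHAPE of the `a = 0, |b| = 1`
clause of (3.65) for King's (2.13) at `A = 0`, NOT a printed proposition; NE2⁺ is NOT PRINTED and not proved here; NOT a node discharge; nothing
continuum ∕ ℝ⁴ ∕ OS ∕ mass-gap ∕ Clay.  0 `sorry`, 0 `def`, standard axioms.

THE POINT.  Part U-b did the Hölder difference in `x` of the `x`-gradient `∂^{(1)}_μG(x, y)` ((3.65), `|a| = 1, b = 0`; bottom level = [Ba 4] (1.9)).  THIS FILE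
does the Hölder difference in `x` of the SOURCE gradient `∂^{(2)}_νG(x, y) := N·[G(x, y + e_ν) − G(x, y)]` — the kernel behind the transposed-gradient
operator `A₀⁻¹∇*_ν` (part Q4a `inv_mulVec_adjDeriv_eq_sum`), for which [Ba 4] prints NO Hölder clause ((1.9) is for `D_μG_kf` only).  The peel runs as in
U-b: per level `ΛL` (one η-difference) times `L^α` (the weight, U-a `div_mul_rpow_neg`); the slice term is part W-a's `ksSliceD2_holder_unif`; the
bottom level `K = 1` needs no Hölder input at all (`N = L` is a constant: `constrainedProp_symm` + [Ba 4] (1.10) clause 2 for `∂^{(1)}G(y, ·)`, weight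
`(ρ∕L)^{−α} ≤ L^α ≤ L`).
* ★★ **`fullPropD2_holder_profile_unif`** — `0 < α < 1`: `∃ C, δ > 0 ∀ K ≥ 1 ∀ N = L^K ∀ cube 2L^e ∀ 0 < m² ≤ m₀² ∀ ν x x′ y,
  (ρ∕N)^{−α}·|∂^{(2)}_νG(x′, y) − ∂^{(2)}_νG(x, y)| ≤ C·Σ_{i<K}(ΛL)^i(L^i)^α·exp(−δ·m·L^i∕N)`, `m = min(|x − y|, |x′ − y|)` — ALL points.
The sequel `…AdjGradHolderOperator` sums the levels against a source for [B9]'s (3.43) second Hölder entry at `U ≡ 1`.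
WHAT THE CURVED CASE ADDS (one line): the same for `G_k(U)∇*_U` uniformly over the live window `Reg335` ([B9] (3.43), printed, no η-rate).
HONEST SCOPE.  (i) `A = 0`, periodic b.c., odd `L ≥ 3`, `0 < m² ≤ m₀²`, cubes `2L^e`, `0 < α < 1`; (ii) lattice units of level `K`; sup torus distance;
(iii) `K ≥ 1`; (iv) Hölder in the observation point, ONE forward difference on the source; (v) not Bałaban's `G_k(U)`; not a discharge.
Locators: [King1986] C. King, CMP **102** (1986) 649–677: (2.13)–(2.17) p. 653, (2.20) p. 654, (3.62), Prop. 3.7 (3.65) p. 663, (4.42)–(4.44) p. 675;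
[Ba 4] = [Balaban1983RegularityDecay] Theorem (1.9)–(1.10) p. 573; [Balaban1985BackgroundPropagators] Thm 3.1 (3.43) p. 398.
-/

noncomputable section

namespace Summit.QuantumFields.YangMills.BalabanUVNodes.N15KingModelRung.Curved

open Real Finset Matrix
open Literature.MathematicalPhysics.QuantumFieldTheory.Balaban1983to89 (Params)
open Literature.MathematicalPhysics.QuantumFieldTheory.Balaban1983to89.B5Prop11Plancherel (Tor fine unitVec)
open Literature.MathematicalPhysics.QuantumFieldTheory.King1986 (aK aK_pos aK_le)
open Literature.MathematicalPhysics.QuantumFieldTheory.King1986.Torus (constrainedProp flatten blockOf tdistT flatten_add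
  flatten_unitVec tdistT_nonneg tdistT_symm tdistT_triangle constrainedProp_deriv_decay_blocks_unif)

variable {d : ℕ} (L : ℕ) [NeZero L]

/-! ## §2 The profile: `(ρ∕N)^{−α}·|∂^{(2)}_νG(x′, y) − ∂^{(2)}_νG(x, y)| ≤ C·Σ_{i<K}(ΛL)^i(L^i)^α·e^{−δ·m·L^i∕N}`, all points -/

/-- **THE HÖLDER-IN-OBSERVATION PROFILE OF THE SOURCE GRADIENT OF KING'S FULL `A = 0` FLUCTUATION PROPAGATOR** (the Hölder difference in `x` of
`∂^{(2)}_νG(x, y) = L^K·[G^η_K(x, y + e_ν) − G^η_K(x, y)]`, `G^η_K = constrainedProp (L^K) M (aK a L K) ((L^K)²) m²`, weight `(|x − x′|∕L^K)^{−α}`): for odd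
`L ≥ 3`, `a > 0`, `m₀² ≥ 0` and `0 < α < 1` there are `C, δ > 0` (functions of `d, L, a, m₀², α`) such that for EVERY `K ≥ 1` (spelling `N = L^K`), cube
`2L^e`, mass `0 < m² ≤ m₀²`, direction `ν` and ALL fine points `x, x′, y`:
`(|x − x′|∕N)^{−α}·|∂^{(2)}_νG(x′, y) − ∂^{(2)}_νG(x, y)| ≤ C·Σ_{i<K}(ΛL)^i·(L^i)^α·exp(−δ·min(|x − y|, |x′ − y|)·L^i∕N)` — the `a = 0, |b| = 1` clause of Prop. 3.7
(3.65) summed over (2.17), for the FULL propagator, uniformly in `K`.  Induction on `K`: bottom = [Ba 4] (1.10) clause 2 for `∂^{(1)}G(y, ·)` through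
`constrainedProp_symm` (no Hölder input: weight `≤ L^α`); step = §1's peel at the two observation points + §1's slice bound + IH, weight rescaled by `L^α`.
[cite: King1986, (2.13)–(2.17) p.653, (2.20) p.654, (3.62) p.663, Prop. 3.7 (3.65) p.663, (4.42)–(4.44) p.675; Balaban1983RegularityDecay, Theorem (1.10) p.573] -/
theorem fullPropD2_holder_profile_unif (hLodd : Odd L) (hL : 2 ≤ L) {a : ℝ} (ha : 0 < a) {m0sq : ℝ} (hm0 : 0 ≤ m0sq)
    {α : ℝ} (hα0 : 0 < α) (hα1 : α < 1) :
    ∃ C δ : ℝ, 0 < C ∧ 0 < δ ∧ ∀ (K : ℕ), 1 ≤ K → ∀ (N : ℕ) [NeZero N], N = L ^ K →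
      ∀ (e : ℕ) (M : Fin (d + 1) → ℕ) [∀ μ, NeZero (M μ)], (∀ μ, M μ = 2 * L ^ e) →
      ∀ (msq : ℝ), 0 < msq → msq ≤ m0sq → ∀ (ν : Fin (d + 1)) (x x' y : Tor (fine N M)),
        (tdistT (fine N M) x x' / (N : ℝ)) ^ (-α) *
          |((N : ℝ) * (constrainedProp N M (aK a L K) (((N : ℕ) : ℝ) ^ 2) msq x' (y + unitVec (fine N M) ν)
              - constrainedProp N M (aK a L K) (((N : ℕ) : ℝ) ^ 2) msq x' y)
            - (N : ℝ) * (constrainedProp N M (aK a L K) (((N : ℕ) : ℝ) ^ 2) msq x (y + unitVec (fine N M) ν)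
              - constrainedProp N M (aK a L K) (((N : ℕ) : ℝ) ^ 2) msq x y))|
          ≤ C * ∑ i ∈ Finset.range K, ((L : ℝ) ^ (d + 1) / (L : ℝ) ^ 2 * L) ^ i * ((L : ℝ) ^ i) ^ α
              * Real.exp (-(δ * (min (tdistT (fine N M) x y) (tdistT (fine N M) x' y) * (L : ℝ) ^ i / (N : ℝ)))) := by
  have hL1 : 1 < L := by omega
  have hLr : (1 : ℝ) ≤ L := by exact_mod_cast hL1.le
  have hL0 : (0 : ℝ) < L := by positivity
  -- the base constants ([Ba 4] (1.10) clause 2, point source, mass inside) and the slice constants (§1)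
  obtain ⟨δb, cb, hδb, hcb, Hb⟩ := constrainedProp_deriv_decay_blocks_unif (d + 1) L (by omega) ⟨hLodd, hL1⟩ ha hm0
  obtain ⟨Cs, κ, hCs, hκ, Hs⟩ := ksSliceD2_holder_unif (d := d) L hLodd hL ha hm0 hα0 hα1
  -- the constants of the theorem
  set Λ : ℝ := (L : ℝ) ^ (d + 1) / (L : ℝ) ^ 2 * L with hΛdef
  have hΛ : 0 < Λ := by positivity
  have hLα : 0 < (L : ℝ) ^ α := Real.rpow_pos_of_pos hL0 α
  set δ : ℝ := min δb κ with hδdef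
  have hδ : 0 < δ := lt_min hδb hκ
  have hδb' : δ ≤ δb := min_le_left _ _
  have hδκ : δ ≤ κ := min_le_right _ _
  set C : ℝ := max (2 * ((L : ℝ) * ((L : ℝ) ^ (d + 1) * cb)) * Real.exp δb) (Λ * (L : ℝ) ^ α * (2 * Cs * Real.exp κ)) with hCdef
  have hC : 0 < C := lt_max_of_lt_right (by positivity)
  have hCb : 2 * ((L : ℝ) * ((L : ℝ) ^ (d + 1) * cb)) * Real.exp δb ≤ C := le_max_left _ _
  have hCsC : Λ * (L : ℝ) ^ α * (2 * Cs * Real.exp κ) ≤ C := le_max_right _ _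
  refine ⟨C, δ, hC, hδ, ?_⟩
  intro K hK
  induction K, hK using Nat.le_induction with
  | base =>
    -- `K = 1`: no Hölder input — the weight is `≤ L^α ≤ L`, each source gradient is (1.10) clause 2 through the symmetry of `G`
    intro N _ hN e M _ hM msq hmsq hcap ν x x' y
    subst hN
    set P : Params := ⟨d + 1, L, e, 1, by omega, ⟨hLodd, hL1⟩⟩ with hPdef
    have hMK : ∀ μ, M μ = P.sitesPerDir P.K := fun μ => by
      rw [hM μ]
      simp [hPdef, Params.sitesPerDir]
    set r : ℝ := tdistT (fine (L ^ 1) M) x y with hrdef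
    set r' : ℝ := tdistT (fine (L ^ 1) M) x' y with hr'def
    set m : ℝ := min r r' with hmdef
    have hN1 : ((L ^ 1 : ℕ) : ℝ) = L := by push_cast; ring
    rw [Finset.sum_range_one, pow_zero, pow_zero, Real.one_rpow, one_mul, one_mul, mul_one]
    conv_rhs => rw [hN1]
    by_cases hxx : x' = x
    · rw [hxx, sub_self, abs_zero, mul_zero]
      positivity
    -- the weight: `ρ ≥ 1`, so `(ρ∕L)^{−α} = (L∕ρ)^α ≤ L^α ≤ L`
    set ρ : ℝ := tdistT (fine (L ^ 1) M) x x' with hρdef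
    have hρ1 : 1 ≤ ρ := by rw [hρdef, tdistT_symm]; exact one_le_tdistT_of_ne _ hxx
    have hρ0 : 0 < ρ := by linarith
    have hwL : (ρ / (((L ^ 1 : ℕ) : ℝ))) ^ (-α) ≤ (L : ℝ) := by
      rw [hN1, Real.rpow_neg (div_nonneg hρ0.le hL0.le), ← Real.inv_rpow (div_nonneg hρ0.le hL0.le), inv_div]
      calc ((L : ℝ) / ρ) ^ α ≤ (L : ℝ) ^ α :=
            Real.rpow_le_rpow (div_nonneg hL0.le hρ0.le) (div_le_self hL0.le hρ1) hα0.le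
        _ ≤ (L : ℝ) ^ (1 : ℝ) := Real.rpow_le_rpow_of_exponent_le hLr hα1.le
        _ = L := Real.rpow_one _
    have hw0 : 0 ≤ (ρ / (((L ^ 1 : ℕ) : ℝ))) ^ (-α) := Real.rpow_nonneg (div_nonneg hρ0.le (Nat.cast_nonneg _)) _
    -- the two source gradients through the symmetry `G(u, v) = G(v, u)` and (1.10) clause 2 at `(y, x′)`, `(y, x)`
    have h1 := Hb P rfl rfl le_rfl msq hmsq.le hcap M hMK (L ^ 1) rfl y x' ν
    have h0 := Hb P rfl rfl le_rfl msq hmsq.le hcap M hMK (L ^ 1) rfl y x ν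
    have hcast : (((L ^ 1 : ℕ) : ℝ)) ^ P.d * cb = (L : ℝ) ^ (d + 1) * cb := by
      simp [hPdef]
    rw [hcast] at h1 h0
    set D : ℝ := tdistT M (blockOf (L ^ 1) M x) (blockOf (L ^ 1) M y) with hDdef
    set D' : ℝ := tdistT M (blockOf (L ^ 1) M x') (blockOf (L ^ 1) M y) with hD'def
    rw [tdistT_symm] at h1 h0
    have hfine : r ≤ (L : ℝ) * D + ((L : ℝ) - 1) := by
      have h' := tdistT_fine_le_blocks (L ^ 1) M x y
      rwa [hN1] at h'
    have hfine' : r' ≤ (L : ℝ) * D' + ((L : ℝ) - 1) := by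
      have h' := tdistT_fine_le_blocks (L ^ 1) M x' y
      rwa [hN1] at h'
    have hmr : m ≤ r := min_le_left _ _
    have hmr' : m ≤ r' := min_le_right _ _
    have hexp_m : ∀ {s : ℝ}, m ≤ s → Real.exp (-(δ * (s / L))) ≤ Real.exp (-(δ * (m / L))) := fun hms =>
      Real.exp_le_exp.mpr (neg_le_neg (mul_le_mul_of_nonneg_left (div_le_div_of_nonneg_right hms hL0.le) hδ.le))
    have hexp0 : Real.exp (-(δb * D)) ≤ Real.exp δb * Real.exp (-(δ * (m / L))) :=
      (exp_block_decay_le hLr le_rfl (tdistT_nonneg _ x y) hδ.le hδb' hfine).trans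
        (mul_le_mul_of_nonneg_left (hexp_m hmr) (Real.exp_pos _).le)
    have hexp1 : Real.exp (-(δb * D')) ≤ Real.exp δb * Real.exp (-(δ * (m / L))) :=
      (exp_block_decay_le hLr le_rfl (tdistT_nonneg _ x' y) hδ.le hδb' hfine').trans
        (mul_le_mul_of_nonneg_left (hexp_m hmr') (Real.exp_pos _).le)
    -- the source gradients as observation gradients of the symmetric kernel
    have hsym : ∀ u : Tor (fine (L ^ 1) M),
        (((L ^ 1 : ℕ) : ℝ)) * (constrainedProp (L ^ 1) M (aK a L 1) (((L ^ 1 : ℕ) : ℝ) ^ 2) msq u (y + unitVec (fine (L ^ 1) M) ν)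
          - constrainedProp (L ^ 1) M (aK a L 1) (((L ^ 1 : ℕ) : ℝ) ^ 2) msq u y)
        = (((L ^ 1 : ℕ) : ℝ)) * (constrainedProp (L ^ 1) M (aK a L 1) (((L ^ 1 : ℕ) : ℝ) ^ 2) msq (y + unitVec (fine (L ^ 1) M) ν) u
          - constrainedProp (L ^ 1) M (aK a L 1) (((L ^ 1 : ℕ) : ℝ) ^ 2) msq y u) := fun u => by
      rw [constrainedProp_symm (L ^ 1) M _ _ _ u (y + _), constrainedProp_symm (L ^ 1) M _ _ _ u y]
    rw [hsym x', hsym x]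
    set A1 : ℝ := (((L ^ 1 : ℕ) : ℝ)) * (constrainedProp (L ^ 1) M (aK a L 1) (((L ^ 1 : ℕ) : ℝ) ^ 2) msq
        (y + unitVec (fine (L ^ 1) M) ν) x' - constrainedProp (L ^ 1) M (aK a L 1) (((L ^ 1 : ℕ) : ℝ) ^ 2) msq y x') with hA1
    set A0 : ℝ := (((L ^ 1 : ℕ) : ℝ)) * (constrainedProp (L ^ 1) M (aK a L 1) (((L ^ 1 : ℕ) : ℝ) ^ 2) msq
        (y + unitVec (fine (L ^ 1) M) ν) x - constrainedProp (L ^ 1) M (aK a L 1) (((L ^ 1 : ℕ) : ℝ) ^ 2) msq y x) with hA0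
    calc (ρ / (((L ^ 1 : ℕ) : ℝ))) ^ (-α) * |A1 - A0| ≤ (L : ℝ) * (|A1| + |A0|) :=
          mul_le_mul hwL (abs_sub _ _) (abs_nonneg _) hL0.le
      _ ≤ (L : ℝ) * ((L : ℝ) ^ (d + 1) * cb * Real.exp (-(δb * D')) + (L : ℝ) ^ (d + 1) * cb * Real.exp (-(δb * D))) :=
          mul_le_mul_of_nonneg_left (add_le_add h1 h0) hL0.le
      _ ≤ (L : ℝ) * ((L : ℝ) ^ (d + 1) * cb * (Real.exp δb * Real.exp (-(δ * (m / L))))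
            + (L : ℝ) ^ (d + 1) * cb * (Real.exp δb * Real.exp (-(δ * (m / L))))) :=
          mul_le_mul_of_nonneg_left (add_le_add (mul_le_mul_of_nonneg_left hexp1 (by positivity))
            (mul_le_mul_of_nonneg_left hexp0 (by positivity))) hL0.le
      _ = 2 * ((L : ℝ) * ((L : ℝ) ^ (d + 1) * cb)) * Real.exp δb * Real.exp (-(δ * (m / L))) := by ring
      _ ≤ C * Real.exp (-(δ * (m / L))) := mul_le_mul_of_nonneg_right hCb (Real.exp_pos _).le
  | succ K hK IH =>
    intro N _ hN e M _ hM msq hmsq hcap ν xf xf' yf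
    subst hN
    obtain rfl : M = fun _ => 2 * L ^ e := funext hM
    set i : KSliceIdx d := ⟨e, K, hK, 1, le_rfl, 0, Nat.zero_le e, 1, le_rfl⟩ with hidef
    obtain ⟨x, rfl⟩ := (flatten (L ^ K) L (ksM L i)).surjective xf
    obtain ⟨x', rfl⟩ := (flatten (L ^ K) L (ksM L i)).surjective xf'
    obtain ⟨y, rfl⟩ := (flatten (L ^ K) L (ksM L i)).surjective yf
    -- the fine distances (preserved by the peel) and the block distances one level down
    set ρ : ℝ := tdistT (fine (L ^ K) (ksU L i)) x x' with hρdef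
    set r : ℝ := tdistT (fine (L ^ K) (ksU L i)) x y with hrdef
    set r' : ℝ := tdistT (fine (L ^ K) (ksU L i)) x' y with hr'def
    set m : ℝ := min r r' with hmdef
    set Dsub : ℝ := tdistT (ksU L i) (blockOf (L ^ K) (ksU L i) x) (blockOf (L ^ K) (ksU L i) y) with hDsubdef
    set Dsub' : ℝ := tdistT (ksU L i) (blockOf (L ^ K) (ksU L i) x') (blockOf (L ^ K) (ksU L i) y) with hDsub'def
    set NK : ℝ := ((L ^ K : ℕ) : ℝ) with hNKdef
    have hNK1 : 1 ≤ NK := by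
      rw [hNKdef]
      exact_mod_cast Nat.one_le_pow K L (by omega)
    have hNK0 : 0 < NK := by linarith
    have hNKL : NK ≤ NK * L := le_mul_of_one_le_right hNK0.le hLr
    have hcastN : ((L ^ K * L : ℕ) : ℝ) = NK * L := by rw [hNKdef]; push_cast; ring
    have hρ0 : 0 ≤ ρ := tdistT_nonneg _ x x'
    have hr0 : 0 ≤ r := tdistT_nonneg _ x y
    have hr'0 : 0 ≤ r' := tdistT_nonneg _ x' y
    have hfine : r ≤ NK * Dsub + (NK - 1) := tdistT_fine_le_blocks (L ^ K) (ksU L i) x y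
    have hfine' : r' ≤ NK * Dsub' + (NK - 1) := tdistT_fine_le_blocks (L ^ K) (ksU L i) x' y
    have hmr : m ≤ r := min_le_left _ _
    have hmr' : m ≤ r' := min_le_right _ _
    -- the mass one level down
    have hL2 : (0 : ℝ) < (L : ℝ) ^ 2 := by positivity
    have hm2 : 0 < msq / (L : ℝ) ^ 2 := div_pos hmsq hL2
    have hm2cap : msq / (L : ℝ) ^ 2 ≤ m0sq := by
      have h1 : (1 : ℝ) ≤ (L : ℝ) ^ 2 := one_le_pow₀ hLr
      exact (div_le_self hmsq.le h1).trans hcap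
    -- the weight at the finer level
    set w : ℝ := (ρ / NK) ^ (-α) with hwdef
    have hw0 : 0 ≤ w := Real.rpow_nonneg (div_nonneg hρ0 hNK0.le) _
    -- the source-gradient difference one level down and the slice difference
    set A : ℝ := ((L ^ K : ℕ) : ℝ) *
            (constrainedProp (L ^ K) (ksU L i) (aK a L K) (((L ^ K : ℕ) : ℝ) ^ 2) (msq / (L : ℝ) ^ 2)
                x' (y + unitVec (fine (L ^ K) (ksU L i)) ν)
              - constrainedProp (L ^ K) (ksU L i) (aK a L K) (((L ^ K : ℕ) : ℝ) ^ 2) (msq / (L : ℝ) ^ 2) x' y)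
          - ((L ^ K : ℕ) : ℝ) *
            (constrainedProp (L ^ K) (ksU L i) (aK a L K) (((L ^ K : ℕ) : ℝ) ^ 2) (msq / (L : ℝ) ^ 2)
                x (y + unitVec (fine (L ^ K) (ksU L i)) ν)
              - constrainedProp (L ^ K) (ksU L i) (aK a L K) (((L ^ K : ℕ) : ℝ) ^ 2) (msq / (L : ℝ) ^ 2) x y) with hAdef
    set S : ℝ := triple (ksH L a (msq / (L : ℝ) ^ 2) i x') (ksC L a (msq / (L : ℝ) ^ 2) i) (ksDH L a (msq / (L : ℝ) ^ 2) i ν y)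
        - triple (ksH L a (msq / (L : ℝ) ^ 2) i x) (ksC L a (msq / (L : ℝ) ^ 2) i) (ksDH L a (msq / (L : ℝ) ^ 2) i ν y) with hSdef
    -- the induction hypothesis on the finer cube, ALL points
    have hM' : ∀ μ, ksU L i μ = 2 * L ^ (e + 1) := fun μ => by
      show L * (2 * L ^ e) = 2 * L ^ (e + 1)
      ring
    have hIH : w * |A| ≤ C * ∑ j ∈ Finset.range K, Λ ^ j * ((L : ℝ) ^ j) ^ α * Real.exp (-(δ * (m * (L : ℝ) ^ j / NK))) :=
      IH (L ^ K) rfl (e + 1) (ksU L i) hM' (msq / (L : ℝ) ^ 2) hm2 hm2cap ν x x' y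
    -- the slice term: §1, read in fine distance at the NEW top scale `NK·L`
    have hS : w * |S| ≤ Cs * (Real.exp (-(κ * Dsub)) + Real.exp (-(κ * Dsub'))) :=
      Hs (msq / (L : ℝ) ^ 2) hm2 hm2cap i ν x x' y
    have hexp_m : ∀ {s : ℝ}, m ≤ s → Real.exp (-(δ * (s / (NK * L)))) ≤ Real.exp (-(δ * (m / (NK * L)))) := fun hms =>
      Real.exp_le_exp.mpr (neg_le_neg (mul_le_mul_of_nonneg_left
        (div_le_div_of_nonneg_right hms (by positivity)) hδ.le))
    have hexpS : Real.exp (-(κ * Dsub)) ≤ Real.exp κ * Real.exp (-(δ * (m / (NK * L)))) :=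
      (exp_block_decay_le hNK1 hNKL hr0 hδ.le hδκ hfine).trans (mul_le_mul_of_nonneg_left (hexp_m hmr) (Real.exp_pos _).le)
    have hexpS' : Real.exp (-(κ * Dsub')) ≤ Real.exp κ * Real.exp (-(δ * (m / (NK * L)))) :=
      (exp_block_decay_le hNK1 hNKL hr'0 hδ.le hδκ hfine').trans (mul_le_mul_of_nonneg_left (hexp_m hmr') (Real.exp_pos _).le)
    have hS' : w * |S| ≤ 2 * Cs * Real.exp κ * Real.exp (-(δ * (m / (NK * L)))) := by
      calc w * |S| ≤ Cs * (Real.exp (-(κ * Dsub)) + Real.exp (-(κ * Dsub'))) := hS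
        _ ≤ Cs * (Real.exp κ * Real.exp (-(δ * (m / (NK * L)))) + Real.exp κ * Real.exp (-(δ * (m / (NK * L))))) :=
            mul_le_mul_of_nonneg_left (add_le_add hexpS hexpS') hCs.le
        _ = 2 * Cs * Real.exp κ * Real.exp (-(δ * (m / (NK * L)))) := by ring
    -- the peel at the two observation points (§1, by name; types restated in the goal's spelling)
    have hpx' : ((L ^ K * L : ℕ) : ℝ) *
        (constrainedProp (L ^ K * L) (ksM L i) (aK a L (K + 1)) (((L ^ K * L : ℕ) : ℝ) ^ 2) msq
            (flatten (L ^ K) L (ksM L i) x') (flatten (L ^ K) L (ksM L i) y + unitVec (fine (L ^ K * L) (ksM L i)) ν)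
          - constrainedProp (L ^ K * L) (ksM L i) (aK a L (K + 1)) (((L ^ K * L : ℕ) : ℝ) ^ 2) msq
            (flatten (L ^ K) L (ksM L i) x') (flatten (L ^ K) L (ksM L i) y))
      = Λ * (((L ^ K : ℕ) : ℝ) *
              (constrainedProp (L ^ K) (ksU L i) (aK a L K) (((L ^ K : ℕ) : ℝ) ^ 2) (msq / (L : ℝ) ^ 2)
                  x' (y + unitVec (fine (L ^ K) (ksU L i)) ν)
                - constrainedProp (L ^ K) (ksU L i) (aK a L K) (((L ^ K : ℕ) : ℝ) ^ 2) (msq / (L : ℝ) ^ 2) x' y)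
            + triple (ksH L a (msq / (L : ℝ) ^ 2) i x') (ksC L a (msq / (L : ℝ) ^ 2) i) (ksDH L a (msq / (L : ℝ) ^ 2) i ν y)) :=
      fullPropD2_peel L hL ha hmsq i ν x' y
    have hpx : ((L ^ K * L : ℕ) : ℝ) *
        (constrainedProp (L ^ K * L) (ksM L i) (aK a L (K + 1)) (((L ^ K * L : ℕ) : ℝ) ^ 2) msq
            (flatten (L ^ K) L (ksM L i) x) (flatten (L ^ K) L (ksM L i) y + unitVec (fine (L ^ K * L) (ksM L i)) ν)
          - constrainedProp (L ^ K * L) (ksM L i) (aK a L (K + 1)) (((L ^ K * L : ℕ) : ℝ) ^ 2) msq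
            (flatten (L ^ K) L (ksM L i) x) (flatten (L ^ K) L (ksM L i) y))
      = Λ * (((L ^ K : ℕ) : ℝ) *
              (constrainedProp (L ^ K) (ksU L i) (aK a L K) (((L ^ K : ℕ) : ℝ) ^ 2) (msq / (L : ℝ) ^ 2)
                  x (y + unitVec (fine (L ^ K) (ksU L i)) ν)
                - constrainedProp (L ^ K) (ksU L i) (aK a L K) (((L ^ K : ℕ) : ℝ) ^ 2) (msq / (L : ℝ) ^ 2) x y)
            + triple (ksH L a (msq / (L : ℝ) ^ 2) i x) (ksC L a (msq / (L : ℝ) ^ 2) i) (ksDH L a (msq / (L : ℝ) ^ 2) i ν y)) :=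
      fullPropD2_peel L hL ha hmsq i ν x y
    have hpeel : ((L ^ K * L : ℕ) : ℝ) *
            (constrainedProp (L ^ K * L) (ksM L i) (aK a L (K + 1)) (((L ^ K * L : ℕ) : ℝ) ^ 2) msq
                (flatten (L ^ K) L (ksM L i) x') (flatten (L ^ K) L (ksM L i) y + unitVec (fine (L ^ K * L) (ksM L i)) ν)
              - constrainedProp (L ^ K * L) (ksM L i) (aK a L (K + 1)) (((L ^ K * L : ℕ) : ℝ) ^ 2) msq
                (flatten (L ^ K) L (ksM L i) x') (flatten (L ^ K) L (ksM L i) y))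
          - ((L ^ K * L : ℕ) : ℝ) *
            (constrainedProp (L ^ K * L) (ksM L i) (aK a L (K + 1)) (((L ^ K * L : ℕ) : ℝ) ^ 2) msq
                (flatten (L ^ K) L (ksM L i) x) (flatten (L ^ K) L (ksM L i) y + unitVec (fine (L ^ K * L) (ksM L i)) ν)
              - constrainedProp (L ^ K * L) (ksM L i) (aK a L (K + 1)) (((L ^ K * L : ℕ) : ℝ) ^ 2) msq
                (flatten (L ^ K) L (ksM L i) x) (flatten (L ^ K) L (ksM L i) y))
        = Λ * (A + S) := by
      rw [hpx', hpx, hAdef, hSdef]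
      ring
    -- the weight one level up
    have hweight : (tdistT (fine (L ^ K * L) (ksM L i)) (flatten (L ^ K) L (ksM L i) x) (flatten (L ^ K) L (ksM L i) x')
          / ((L ^ K * L : ℕ) : ℝ)) ^ (-α) = (L : ℝ) ^ α * w := by
      rw [tdistT_flatten, hcastN, ← hρdef, hwdef]
      exact div_mul_rpow_neg hρ0 hNK0 hL0
    -- the level sums
    have hshift : ∀ j : ℕ, Λ ^ (j + 1) * ((L : ℝ) ^ (j + 1)) ^ α * Real.exp (-(δ * (m * (L : ℝ) ^ (j + 1) / (NK * L))))
        = Λ * (L : ℝ) ^ α * (Λ ^ j * ((L : ℝ) ^ j) ^ α * Real.exp (-(δ * (m * (L : ℝ) ^ j / NK)))) := fun j => by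
      have he : m * (L : ℝ) ^ (j + 1) / (NK * L) = m * (L : ℝ) ^ j / NK := by
        rw [pow_succ, ← mul_assoc, mul_div_mul_right _ _ hL0.ne']
      rw [he, pow_succ, pow_succ, Real.mul_rpow (pow_nonneg hL0.le _) hL0.le]
      ring
    have hsum : ∑ j ∈ Finset.range (K + 1), Λ ^ j * ((L : ℝ) ^ j) ^ α * Real.exp (-(δ * (m * (L : ℝ) ^ j / (NK * L))))
        = Real.exp (-(δ * (m / (NK * L))))
          + Λ * (L : ℝ) ^ α * ∑ j ∈ Finset.range K, Λ ^ j * ((L : ℝ) ^ j) ^ α * Real.exp (-(δ * (m * (L : ℝ) ^ j / NK))) := by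
      rw [Finset.sum_range_succ', pow_zero, pow_zero, Real.one_rpow, one_mul, one_mul, mul_one, Finset.mul_sum, add_comm]
      congr 1
      exact Finset.sum_congr rfl fun j _ => hshift j
    -- the goal in the peel's spelling, fine distances through `tdistT_flatten`
    show (tdistT (fine (L ^ K * L) (ksM L i)) (flatten (L ^ K) L (ksM L i) x) (flatten (L ^ K) L (ksM L i) x')
            / ((L ^ K * L : ℕ) : ℝ)) ^ (-α) *
        |((L ^ K * L : ℕ) : ℝ) *
            (constrainedProp (L ^ K * L) (ksM L i) (aK a L (K + 1)) (((L ^ K * L : ℕ) : ℝ) ^ 2) msq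
                (flatten (L ^ K) L (ksM L i) x') (flatten (L ^ K) L (ksM L i) y + unitVec (fine (L ^ K * L) (ksM L i)) ν)
              - constrainedProp (L ^ K * L) (ksM L i) (aK a L (K + 1)) (((L ^ K * L : ℕ) : ℝ) ^ 2) msq
                (flatten (L ^ K) L (ksM L i) x') (flatten (L ^ K) L (ksM L i) y))
          - ((L ^ K * L : ℕ) : ℝ) *
            (constrainedProp (L ^ K * L) (ksM L i) (aK a L (K + 1)) (((L ^ K * L : ℕ) : ℝ) ^ 2) msq
                (flatten (L ^ K) L (ksM L i) x) (flatten (L ^ K) L (ksM L i) y + unitVec (fine (L ^ K * L) (ksM L i)) ν)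
              - constrainedProp (L ^ K * L) (ksM L i) (aK a L (K + 1)) (((L ^ K * L : ℕ) : ℝ) ^ 2) msq
                (flatten (L ^ K) L (ksM L i) x) (flatten (L ^ K) L (ksM L i) y))|
        ≤ C * ∑ j ∈ Finset.range (K + 1), Λ ^ j * ((L : ℝ) ^ j) ^ α * Real.exp (-(δ *
            (min (tdistT (fine (L ^ K * L) (ksM L i)) (flatten (L ^ K) L (ksM L i) x) (flatten (L ^ K) L (ksM L i) y))
                (tdistT (fine (L ^ K * L) (ksM L i)) (flatten (L ^ K) L (ksM L i) x') (flatten (L ^ K) L (ksM L i) y))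
              * (L : ℝ) ^ j / ((L ^ K * L : ℕ) : ℝ))))
    rw [hweight, hpeel, tdistT_flatten, tdistT_flatten, hcastN, ← hrdef, ← hr'def, ← hmdef, hsum, abs_mul, abs_of_nonneg hΛ.le]
    -- assemble
    set PS : ℝ := ∑ j ∈ Finset.range K, Λ ^ j * ((L : ℝ) ^ j) ^ α * Real.exp (-(δ * (m * (L : ℝ) ^ j / NK))) with hPSdef
    set E : ℝ := Real.exp (-(δ * (m / (NK * L)))) with hEdef
    have hE0 : 0 < E := Real.exp_pos _
    have hAS : w * |A + S| ≤ C * PS + 2 * Cs * Real.exp κ * E := by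
      calc w * |A + S| ≤ w * (|A| + |S|) := mul_le_mul_of_nonneg_left (abs_add_le _ _) hw0
        _ = w * |A| + w * |S| := by ring
        _ ≤ C * PS + 2 * Cs * Real.exp κ * E := add_le_add hIH hS'
    calc (L : ℝ) ^ α * w * (Λ * |A + S|) = Λ * (L : ℝ) ^ α * (w * |A + S|) := by ring
      _ ≤ Λ * (L : ℝ) ^ α * (C * PS + 2 * Cs * Real.exp κ * E) :=
          mul_le_mul_of_nonneg_left hAS (by positivity)
      _ = C * (Λ * (L : ℝ) ^ α * PS) + Λ * (L : ℝ) ^ α * (2 * Cs * Real.exp κ) * E := by ring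
      _ ≤ C * (Λ * (L : ℝ) ^ α * PS) + C * E := by
          have := mul_le_mul_of_nonneg_right hCsC hE0.le
          linarith
      _ = C * (E + Λ * (L : ℝ) ^ α * PS) := by ring

end Summit.QuantumFields.YangMills.BalabanUVNodes.N15KingModelRung.Curved
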